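import Summits.QuantumFields.BalabanUV.T4Continuum.Support.NE7TopNormalisedSpikeEnergyLetters
import Summits.QuantumFields.BalabanUV.T4Continuum.Support.NE7TopNormalisedLinearSplit
import Summits.QuantumFields.BalabanUV.T4Continuum.Support.NE3RightInverseLetters
import HarnessLib

/-!
# Support | NE7 (gen 98, ROAD-Γ′ S4a, part 2 — THE TANGENT RESIDUAL UNDER A TRIVIAL TOP FRAME AND ITS TWO ENERGY LETTERS): at NE7's pair with `v_{j+1} ≡ 1`, the field
# `X_N⁰ := gaugeDir W (spikeW M f) + rightInvW (D (X − spikes))`, `f := framePotW L (j+1) W X`, leaves `X − X_N⁰` TANGENT (`D (X − X_N⁰) = 0`, exact) and obeys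
# `‖X_N⁰‖_w ≤ ν₀·‖X‖_w`, `x·Σ_{perWin}‖curl_W X_N⁰‖ ≤ κ₀·‖X‖_w²` with `ν₀ = O(M·b)` and `κ₀ = O(M²x)` k-FREE (`‖·‖_w = energyNormW L (j+1) W · [0,N·M)^d`)

Cell `pub-balaban`, rung (B)+1 sub-cell t4, lineage `b2b-balaban-t4-ne7-p1` (CRUX PROVER NE7 #1 = OWNER of row NE7), generation 98; memo `t4/b2b-balaban-t4-ne7-p1-g98/ROAD-G98.md` §1.
Pure composition of gen 97's S3∕S4 kernel theorems BY NAME: `NE7TopNormalisedLinearSplit.dirIter_sub_spikes_eq_QbarIter` (`D(X − spikes) = QbarIter X`, exact),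
part 1 `NE7TopNormalisedSpikeEnergyLetters.energyNormW_spikes_le_of_top ∕ curlL1_spikes_le_of_top` (the spike letters in energy currency under `log v_{j+1} ≡ 0`),
`NE7TopNormalisedQbarLetters.directLetter_L1_of_frameTrivial ∕ directLetter_L2_of_frameTrivial` ((DL1)∕(DL2) under `v_{j+1} ≡ 1`), row NE3's right-inverse letters
`NE3RightInverseLetters.rightInvW_R1 ∕ curlSq_rightInvW_le ∕ sum_norm_curl_rightInvW_le ∕ rightInvW_exact` ((R1)–(R3), exactness) and `NE3ProductPathBounds.energyNormW_add_le`.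

WHY (memo ROAD-G97 §4 S3∕S4, ROAD-G98 §1).  ROAD-Γ′ splits the top-normalised representative `X` (S2: trivial accumulated top frame) as `X = X_T + X_N`,
`X_N = spikes + rightInvW(QbarIter X) − gaugeDir W μ`.  THIS FILE closes the letters of the FIRST TWO pieces in the binder's currency (`hdecomp♭` of
`NE7HintOfSliceNormalisationSU2Dec`): `X_N⁰ := spikes + rightInvW(QbarIter X)` has `‖X_N⁰‖_w ≤ (ν_S + ν_R)‖X‖_w` with `ν_S = 2√((#Plane + d)·A₂)·(Mb)`,
`ν_R = √((c₁+c₂)·1024K²(L^d∕L⁴))·(Mb)` and `x·Σ‖curl X_N⁰‖ ≤ (κ_S + κ_R)‖X‖_w²` with `κ_S = 2·#Plane·A₁·(M²x)²`, `κ_R = c₃·(M²x)·K₁(L^d∕L²)` — every constant a polynomial in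
`d, L, C1cov, #Plane`, the four GEOMETRIC-SUM CEILINGS `Γ₁…Γ₄` (hypotheses `hΓ₁…hΓ₄`; at `d = 4`, `L = 2`: `Γ₁ = 2`, `Γ₂ = 1`, `Γ₃ = Γ₄ = 4∕3`) and row NE3's `c₁ = l2C∕(1−θ)²`,
`c₂ = curl2C∕(1−θ)²`, `c₃ = curl1C∕(1−θ)`, `θ = thetaLoc·M²x` — times the two SMALL currencies `M·b` (sup) and `M²x` (plaquette); and `X − X_N⁰` is TANGENT, skew and periodic,
so leaf-02's K0b decomposition applies to it (S4b: the `gaugeDir W μ` piece, whose letters need the Green's-function letter (G) of memo §2).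
WHAT ([folklore]; 0 def, 0 sorry).  §3 the right-inverse letters in energy currency (`energyNormW_rightInv_le_of_frameTrivial`, `curlL1_rightInv_le_of_frameTrivial`);
§4 **`tangentResidual_letters_of_frameTrivial`** (tangency + skew + periodic + the two letters of `X_N⁰`).  (§§1–2 = part 1.)
HONEST FRAMING (page 1): composition and real arithmetic over landed kernel theorems; nothing of Bałaban's asserted; S2 (existence of a top-normalised representative), the
`gaugeDir W μ` letters (Green's-function letter (G)), `hdecomp♭` and NE7 are NOT proved; spine 0∕9; finite T⁴ rung (B)+1 — NOT infinite volume, NOT mass gap, NOT `BetaPertH`,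
NOT Clay.  Continuum YM on T⁴ ⇐ BetaPertH ∧ nine spine estimates (0/9 proved); BetaPertH ⇐ (D1) ∧ (D4) ∧ CAP+tail; G-an2-4 gates asym, D1 and NE2/3/4.
-/

set_option autoImplicit false

open scoped BigOperators Matrix Matrix.Norms.L2Operator
open NormedSpace Finset

namespace Summit.QuantumFields.BalabanUV.T4Continuum.NE7TopNormalisedResidualLetters

open Literature.MathematicalPhysics.QuantumFieldTheory.Balaban1983to89
open B7Prop1Explicit B7Prop2Explicit B7Prop3Flat MatrixLog
open T4AveragingDeficitWall (Ad IsUnitaryCfg IsSkewDir SmallField vary curl dirL1 dirSq curlSq)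
open T4AveragingDeficitWallBoundary (IsPeriodicCfg periodBox)
open AveragingDeficitPeriodicCounting (IsPeriodicDir)
open AveragingDeficitMultiLevelPrep (cavgIter LevelSmall tower)
open B7Eq92Concrete (vcov)
open NE3TangentCovariantTower (dirIter QbarIter framePotW)
open NE3CovariantLineSumsL2 (l2sq l2sq_nonneg)
open NE3.PairLandauB8Avg (relPert)
open ReplicationRightInverseBound (radSum)
open BlockAverageVaryHolo (nbRad)
open NE3CovariantLineSumsError (Csup)
open ShellMeasureAverageProp4General (C1cov C1cov_pos)
open BlockAveragePushDirGauge (gaugeDir)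
open NE3CornerSpikes (spikeW)
open NE3QbarIterCovLiftPrep (cruxC)
open NE3SmoothRightInverseW (rightInvW)
open NE3RightInverseSolveLetters (thetaLoc)
open NE3RightInverseL2Letter (l2C l2C_nonneg)
open NE3HatInvCurlLetters (curl2C curl1C curl2C_nonneg curl1C_nonneg)
open NE3RightInverseLetters (rightInvW_R1 curlSq_rightInvW_le sum_norm_curl_rightInvW_le rightInvW_exact rightInvW_skew rightInvW_periodic)
open NE3EnergyWeightedShapes (energyNormW energyNormW_nonneg)
open NE3ProductPathBounds (energySq_nonneg energyNormW_add_le curl_add_dir)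
open NE3EnergyHessContTwoTerm (curlSq_nonneg dirSq_nonneg)
open NE3EnergyRateWSupRoutePiRInv (dirIter_skew isPeriodicDir_dirIter)
open NE3ResidualSliceRep (dirIter_sub)
open NE3SmoothLiftW (tower_eq_pow_mul)
open MinimalActionLevels (perWin)
open NE7TopNormalisedLinearSplit (isSkewDir_spikes isPeriodicDir_spikes dirIter_sub_spikes_eq_QbarIter)
open NE7TopNormalisedSpikeEnergyLetters (mlog_vcov_eq_zero_of_frameTrivial energyNormW_le_of_sq_le energyNormW_spikes_le_of_top curlL1_spikes_le_of_top)
open NE7TopNormalisedQbarLetters (directLetter_L1_of_frameTrivial directLetter_L2_of_frameTrivial)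

noncomputable section

variable {d : ℕ} {n : Type*} [Fintype n] [DecidableEq n]

/-! ## §3 The right-inverse letters in the binder's energy currency -/

/-- **THE ν-LETTER OF THE RIGHT-INVERSE PIECE** (regime of `NE7TopNormalisedQbarLetters.directLetter_L2_of_frameTrivial` plus row NE3's W6 regime `cruxC·M²x < 1`,
`thetaLoc·M²x < 1`, `M²x ≤ 1`): for every skew `φ` with `φ = QbarIter L (j+1) W X` (S4: `φ = D(X − spikes)`), `‖rightInvW … φ‖_w ≤ √((c₁+c₂)·1024K²(L^d∕L⁴))·(M·b)·‖X‖_w`,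
`c₁ = l2C∕(1−θ)²`, `c₂ = curl2C∕(1−θ)²`, `θ = thetaLoc·M²x`, `K = C1cov·L²√(d(4L+1)^d)` ((R1) + (R2) + (DL2)). [folklore] -/
theorem energyNormW_rightInv_le_of_frameTrivial [Nonempty n] {L N : ℕ} [NeZero N] (hL : 2 ≤ L) (hN : 1 ≤ N) (j : ℕ)
    {W UA D : Site d → Fin d → (Matrix n n ℂ)ˣ} {u : Site d → (Matrix n n ℂ)ˣ} {x : ℝ} (hWu : IsUnitaryCfg W) (hWP : IsPeriodicCfg W ((N * L ^ (j + 1) : ℕ) : ℤ))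
    (hx : 0 ≤ x) (hsm : LevelSmall d L j x) (hWx : SmallField W x)
    (hθ : cruxC d L * (((L : ℝ) ^ (j + 1)) ^ 2 * x) < 1) (hθl : thetaLoc d L * (((L : ℝ) ^ (j + 1)) ^ 2 * x) < 1) (hε : ((L : ℝ) ^ (j + 1)) ^ 2 * x ≤ 1)
    {α₀ b : ℝ} (hα : 0 < α₀) (hα3 : C0 d * (2 * α₀) ≤ 1 / 3) (hα4 : 4 * (2 * α₀) ≤ c2' d L)
    (h52 : pdev W < α₀ * (((L : ℝ) ^ (j + 1))⁻¹) ^ 2) (hb : 0 ≤ b)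
    {X : Site d → Fin d → Matrix n n ℂ} (hX : ∀ (y : Site d) (κ : Fin d), ‖X y κ‖ ≤ b) (hXP : IsPeriodicDir X ((N * L ^ (j + 1) : ℕ) : ℤ))
    (hsmall : Real.exp (4 * (800 * ((d : ℝ) + 1) ^ 2 * ((d : ℝ) + 4)) * α₀)
      * (1 + 8 * (131072 * ((d : ℝ) + 1) ^ 2) * ((L : ℝ) ^ (j + 1) * b)) ≤ 2)
    (hc₃ : 4 * ((L : ℝ) ^ (j + 1) * b) ≤ c3 d L)
    (hK : 16 * (C1cov d * (L : ℝ) ^ 2 * Real.sqrt (d * (2 * (2 * L) + 1) ^ d)) * (L : ℝ) ^ (j + 1) * b ≤ Real.sqrt ((L : ℝ) ^ 2 / (L : ℝ) ^ d))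
    (hrep : gaugeAct u UA = vary W X 1) (hcorner : ∀ z : Site d, u (((L : ℤ) ^ (j + 1)) • z) = 1)
    (hA : avgIter L UA (j + 1) = D) (hW : avgIter L W (j + 1) = D)
    (hv1 : ∀ z : Site d, vcov L W (relPert W X) (j + 1) z = 1)
    {φ : Site d → Fin d → Matrix n n ℂ} (hφs : IsSkewDir φ) (hφ : φ = QbarIter L (j + 1) W X) :
    energyNormW L (j + 1) W (rightInvW hL j hWu hx hsm hWx N hθ hφs) (periodBox (d := d) (N * L ^ (j + 1)))
      ≤ Real.sqrt ((l2C d L / (1 - thetaLoc d L * (((L : ℝ) ^ (j + 1)) ^ 2 * x)) ^ 2 + curl2C d L / (1 - thetaLoc d L * (((L : ℝ) ^ (j + 1)) ^ 2 * x)) ^ 2)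
            * (1024 * (C1cov d * (L : ℝ) ^ 2 * Real.sqrt (d * (2 * (2 * L) + 1) ^ d)) ^ 2 * ((L : ℝ) ^ d / (L : ℝ) ^ 4)))
          * ((L : ℝ) ^ (j + 1) * b) * energyNormW L (j + 1) W X (periodBox (d := d) (N * L ^ (j + 1))) := by
  have hL0 : (0 : ℝ) < L := by exact_mod_cast (show 0 < L by omega)
  have hT : ((tower L N (j + 1) : ℕ) : ℤ) = ((N * L ^ (j + 1) : ℕ) : ℤ) := by rw [tower_eq_pow_mul, Nat.mul_comm]
  have hWPt : IsPeriodicCfg W ((tower L N (j + 1) : ℕ) : ℤ) := by rw [hT]; exact hWP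
  -- the direct letter (DL2) and the right-inverse letters (R1), (R2), fetched before the abbreviations
  have hDL2 := directLetter_L2_of_frameTrivial hL hN j hWu hWP hx hsm hWx hα hα3 hα4 h52 hb hX hXP hsmall hc₃ hK hrep hcorner hA hW hv1
  rw [← hφ] at hDL2
  have hR1 := rightInvW_R1 hL j hWu hWPt hx hsm hWx hθ hθl hε hφs
  have hR2 := curlSq_rightInvW_le hL j hWu hWPt hx hsm hWx hθ hθl hε hφs
  set M : ℝ := (L : ℝ) ^ (j + 1) with hMdef
  have hM0 : 0 < M := by positivity
  set K : ℝ := C1cov d * (L : ℝ) ^ 2 * Real.sqrt (d * (2 * (2 * L) + 1) ^ d) with hKdef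
  have h1θ : 0 < 1 - thetaLoc d L * (M ^ 2 * x) := by linarith
  set c₁ : ℝ := l2C d L / (1 - thetaLoc d L * (M ^ 2 * x)) ^ 2 with hc₁
  set c₂ : ℝ := curl2C d L / (1 - thetaLoc d L * (M ^ 2 * x)) ^ 2 with hc₂
  have hc₁0 : 0 ≤ c₁ := by rw [hc₁]; have := l2C_nonneg d L; positivity
  have hc₂0 : 0 ≤ c₂ := by rw [hc₂]; have := curl2C_nonneg d L; positivity
  set F := periodBox (d := d) (N * L ^ (j + 1)) with hF
  set E : ℝ := energyNormW L (j + 1) W X F with hE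
  have hE0 : 0 ≤ E := energyNormW_nonneg _ _ _ _ _
  set Nn := rightInvW hL j hWu hx hsm hWx N hθ hφs with hNn
  set Dφ : ℝ := dirSq φ (periodBox (d := d) N) with hDφ
  have hDφ0 : 0 ≤ Dφ := dirSq_nonneg _ _
  set Q : ℝ := 1024 * K ^ 2 * ((L : ℝ) ^ d / (L : ℝ) ^ 4) with hQ
  have hQ0 : 0 ≤ Q := by rw [hQ]; positivity
  -- hDL2 : M^d/M^4 * Dφ ≤ (1024 K² (L^d/L⁴) (M b)²) * E²
  have hDL2' : M ^ d / M ^ 4 * Dφ ≤ Q * (M * b) ^ 2 * E ^ 2 := by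
    have e : 1024 * K ^ 2 * ((L : ℝ) ^ d / (L : ℝ) ^ 4) * (M * b) ^ 2 * E ^ 2 = Q * (M * b) ^ 2 * E ^ 2 := by rw [hQ]
    rw [← e]; exact hDL2
  set c : ℝ := Real.sqrt ((c₁ + c₂) * Q) * (M * b) * E with hc
  have hc0 : 0 ≤ c := by rw [hc]; positivity
  refine energyNormW_le_of_sq_le L j W _ F hc0 ?_
  have hsq : Real.sqrt ((c₁ + c₂) * Q) ^ 2 = (c₁ + c₂) * Q := Real.sq_sqrt (by positivity)
  have e : c ^ 2 = (c₁ + c₂) * (Q * (M * b) ^ 2 * E ^ 2) := by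
    rw [hc]
    calc (Real.sqrt ((c₁ + c₂) * Q) * (M * b) * E) ^ 2 = Real.sqrt ((c₁ + c₂) * Q) ^ 2 * (M * b) ^ 2 * E ^ 2 := by ring
      _ = (c₁ + c₂) * (Q * (M * b) ^ 2 * E ^ 2) := by rw [hsq]; ring
  rw [e]
  have h1 : (M⁻¹) ^ 2 * dirSq Nn F ≤ (M⁻¹) ^ 2 * (c₁ * (M ^ d / M ^ 2) * Dφ) := mul_le_mul_of_nonneg_left hR1 (by positivity)
  have h2 : (M⁻¹) ^ 2 * (c₁ * (M ^ d / M ^ 2) * Dφ) = c₁ * (M ^ d / M ^ 4 * Dφ) := by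
    have hM' : M ≠ 0 := hM0.ne'
    field_simp
  have h2' : c₂ * (M ^ d / M ^ 4) * Dφ = c₂ * (M ^ d / M ^ 4 * Dφ) := by ring
  calc curlSq W Nn F + (M⁻¹) ^ 2 * dirSq Nn F ≤ c₂ * (M ^ d / M ^ 4) * Dφ + (M⁻¹) ^ 2 * (c₁ * (M ^ d / M ^ 2) * Dφ) := add_le_add hR2 h1
    _ = (c₁ + c₂) * (M ^ d / M ^ 4 * Dφ) := by rw [h2, h2']; ring
    _ ≤ (c₁ + c₂) * (Q * (M * b) ^ 2 * E ^ 2) := mul_le_mul_of_nonneg_left hDL2' (add_nonneg hc₁0 hc₂0)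

/-- **THE κ-LETTER OF THE RIGHT-INVERSE PIECE** (regime of `NE7TopNormalisedQbarLetters.directLetter_L1_of_frameTrivial` plus row NE3's W6 regime): for every skew `φ` with
`φ = QbarIter L (j+1) W X`, `x·Σ_{p∈perWin(N·M)}‖curl_W (rightInvW … φ) p‖ ≤ (curl1C∕(1−θ))·(M²x)·K₁(L^d∕L²)·‖X‖_w²`, `K₁ = 64C1cov·L²d(4L+1)^d` ((R3) + (DL1)). [folklore] -/
theorem curlL1_rightInv_le_of_frameTrivial [Nonempty n] {L N : ℕ} [NeZero N] (hL : 2 ≤ L) (hN : 1 ≤ N) (j : ℕ)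
    {W UA D : Site d → Fin d → (Matrix n n ℂ)ˣ} {u : Site d → (Matrix n n ℂ)ˣ} {x : ℝ} (hWu : IsUnitaryCfg W) (hWP : IsPeriodicCfg W ((N * L ^ (j + 1) : ℕ) : ℤ))
    (hx : 0 ≤ x) (hsm : LevelSmall d L j x) (hWx : SmallField W x)
    (hθ : cruxC d L * (((L : ℝ) ^ (j + 1)) ^ 2 * x) < 1) (hθl : thetaLoc d L * (((L : ℝ) ^ (j + 1)) ^ 2 * x) < 1) (hε : ((L : ℝ) ^ (j + 1)) ^ 2 * x ≤ 1)
    {α₀ b : ℝ} (hα : 0 < α₀) (hα3 : C0 d * (2 * α₀) ≤ 1 / 3) (hα4 : 4 * (2 * α₀) ≤ c2' d L)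
    (h52 : pdev W < α₀ * (((L : ℝ) ^ (j + 1))⁻¹) ^ 2) (hb : 0 ≤ b)
    {X : Site d → Fin d → Matrix n n ℂ} (hX : ∀ (y : Site d) (κ : Fin d), ‖X y κ‖ ≤ b) (hXP : IsPeriodicDir X ((N * L ^ (j + 1) : ℕ) : ℤ))
    (hsmall : Real.exp (4 * (800 * ((d : ℝ) + 1) ^ 2 * ((d : ℝ) + 4)) * α₀)
      * (1 + 8 * (131072 * ((d : ℝ) + 1) ^ 2) * ((L : ℝ) ^ (j + 1) * b)) ≤ 2)
    (hc₃ : 4 * ((L : ℝ) ^ (j + 1) * b) ≤ c3 d L)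
    (hK : 16 * (C1cov d * (L : ℝ) ^ 2 * Real.sqrt (d * (2 * (2 * L) + 1) ^ d)) * (L : ℝ) ^ (j + 1) * b ≤ Real.sqrt ((L : ℝ) ^ 2 / (L : ℝ) ^ d))
    (hS1 : (16 * (d + 1) * (d + 4) * (L : ℝ) ^ 2 * Csup d L * (d * (2 * nbRad d L + 1) ^ d)) * radSum d L j x ≤ ((L : ℝ) / (L : ℝ) ^ d) / 2)
    (hrep : gaugeAct u UA = vary W X 1) (hcorner : ∀ z : Site d, u (((L : ℤ) ^ (j + 1)) • z) = 1)
    (hA : avgIter L UA (j + 1) = D) (hW : avgIter L W (j + 1) = D)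
    (hv1 : ∀ z : Site d, vcov L W (relPert W X) (j + 1) z = 1)
    {φ : Site d → Fin d → Matrix n n ℂ} (hφs : IsSkewDir φ) (hφ : φ = QbarIter L (j + 1) W X) :
    x * ∑ p ∈ perWin d (N * L ^ (j + 1)), ‖curl W (rightInvW hL j hWu hx hsm hWx N hθ hφs) p‖
      ≤ (curl1C d L / (1 - thetaLoc d L * (((L : ℝ) ^ (j + 1)) ^ 2 * x))) * (((L : ℝ) ^ (j + 1)) ^ 2 * x)
          * (64 * (C1cov d * (L : ℝ) ^ 2 * (d * (2 * (2 * (L : ℝ)) + 1) ^ d)) * ((L : ℝ) ^ d / (L : ℝ) ^ 2))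
          * energyNormW L (j + 1) W X (periodBox (d := d) (N * L ^ (j + 1))) ^ 2 := by
  have hL0 : (0 : ℝ) < L := by exact_mod_cast (show 0 < L by omega)
  have hT : ((tower L N (j + 1) : ℕ) : ℤ) = ((N * L ^ (j + 1) : ℕ) : ℤ) := by rw [tower_eq_pow_mul, Nat.mul_comm]
  have hWPt : IsPeriodicCfg W ((tower L N (j + 1) : ℕ) : ℤ) := by rw [hT]; exact hWP
  have hDL1 := directLetter_L1_of_frameTrivial hL hN j hWu hWP hx hsm hWx hα hα3 hα4 h52 hb hX hXP hsmall hc₃ hK hS1 hrep hcorner hA hW hv1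
  rw [← hφ] at hDL1
  have hR3 := sum_norm_curl_rightInvW_le hL j hWu hWPt hx hsm hWx hθ hθl hε hφs
  set M : ℝ := (L : ℝ) ^ (j + 1) with hMdef
  have hM0 : 0 < M := by positivity
  set K₁ : ℝ := 64 * (C1cov d * (L : ℝ) ^ 2 * (d * (2 * (2 * (L : ℝ)) + 1) ^ d)) with hK₁
  have h1θ : 0 < 1 - thetaLoc d L * (M ^ 2 * x) := by linarith
  set c₃ : ℝ := curl1C d L / (1 - thetaLoc d L * (M ^ 2 * x)) with hc₃'
  have hc₃0 : 0 ≤ c₃ := by rw [hc₃']; have := curl1C_nonneg d L; positivity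
  set F := periodBox (d := d) (N * L ^ (j + 1)) with hF
  set E : ℝ := energyNormW L (j + 1) W X F with hE
  set Nn := rightInvW hL j hWu hx hsm hWx N hθ hφs with hNn
  set D₁ : ℝ := dirL1 φ (periodBox (d := d) N) with hD₁
  have e1 : x * (c₃ * (M ^ d / M ^ 2) * D₁) = c₃ * (M ^ 2 * x) * (M ^ d / M ^ 4 * D₁) := by
    have hM' : M ≠ 0 := hM0.ne'
    field_simp
  calc x * ∑ p ∈ perWin d (N * L ^ (j + 1)), ‖curl W Nn p‖ ≤ x * (c₃ * (M ^ d / M ^ 2) * D₁) := mul_le_mul_of_nonneg_left hR3 hx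
    _ = c₃ * (M ^ 2 * x) * (M ^ d / M ^ 4 * D₁) := e1
    _ ≤ c₃ * (M ^ 2 * x) * (K₁ * ((L : ℝ) ^ d / (L : ℝ) ^ 2) * E ^ 2) := mul_le_mul_of_nonneg_left hDL1 (by positivity)
    _ = c₃ * (M ^ 2 * x) * (K₁ * ((L : ℝ) ^ d / (L : ℝ) ^ 2)) * E ^ 2 := by ring

/-! ## §4 The tangent residual `X − X_N⁰` and the two letters of `X_N⁰ = spikes + rightInvW (D (X − spikes))` -/

/-- **ROAD-Γ′ S4a — THE TANGENT RESIDUAL UNDER A TRIVIAL TOP FRAME AND ITS TWO ENERGY LETTERS.**  At NE7's pair (`U_A^{u} = W·e^{X}`, `u` corner-trivial, common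
`(j+1)`-fold average `D`) in the tower class at `W` (period `N·M`, `M = L^{j+1}`, radius `x` with row NE3's W6 regime `cruxC·M²x < 1`, `thetaLoc·M²x < 1`, `M²x ≤ 1`, the Prop-4∕(Γ1)
regime in `α₀, b`, `44dL·Mb ≤ 1`, the ℓ¹ tower line `hS1`) with a TRIVIAL ACCUMULATED TOP FRAME `v_{j+1} ≡ 1`, and geometric-sum ceilings `Γ₁…Γ₄`: with
`S := gaugeDir W (spikeW M (framePotW L (j+1) W X))`, `D(X − S)` is skew and `X_N⁰ := S + rightInvW (D (X − S))` satisfies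
(i) `D(X − X_N⁰) = 0` (TANGENT, exact), (ii) skew, (iii) `(N·M)`-periodic, (iv) `‖X_N⁰‖_w ≤ (ν_S + ν_R)·‖X‖_w`, (v) `x·Σ_{perWin(N·M)}‖curl_W X_N⁰‖ ≤ (κ_S + κ_R)·‖X‖_w²`
with `ν_S = 2√((#Plane+d)A₂)·Mb`, `ν_R = √((c₁+c₂)·1024K²L^d∕L⁴)·Mb`, `κ_S = 2·#Plane·A₁·(M²x)²`, `κ_R = c₃·M²x·K₁L^d∕L²` (§§2–3) — k-FREE given the ceilings. [folklore] -/
theorem tangentResidual_letters_of_frameTrivial [Nonempty n] {L N : ℕ} [NeZero N] (hL : 2 ≤ L) (hN : 1 ≤ N) (j : ℕ)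
    {W UA D : Site d → Fin d → (Matrix n n ℂ)ˣ} {u : Site d → (Matrix n n ℂ)ˣ} {x : ℝ} (hWu : IsUnitaryCfg W) (hWP : IsPeriodicCfg W ((N * L ^ (j + 1) : ℕ) : ℤ))
    (hx : 0 ≤ x) (hsm : LevelSmall d L j x) (hWx : SmallField W x)
    (hθ : cruxC d L * (((L : ℝ) ^ (j + 1)) ^ 2 * x) < 1) (hθl : thetaLoc d L * (((L : ℝ) ^ (j + 1)) ^ 2 * x) < 1) (hε : ((L : ℝ) ^ (j + 1)) ^ 2 * x ≤ 1)
    {α₀ b : ℝ} (hα : 0 < α₀) (hα3 : C0 d * (2 * α₀) ≤ 1 / 3) (hα4 : 4 * (2 * α₀) ≤ c2' d L)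
    (h52 : pdev W < α₀ * (((L : ℝ) ^ (j + 1))⁻¹) ^ 2) (hb : 0 ≤ b)
    {X : Site d → Fin d → Matrix n n ℂ} (hX : ∀ (y : Site d) (κ : Fin d), ‖X y κ‖ ≤ b) (hXP : IsPeriodicDir X ((N * L ^ (j + 1) : ℕ) : ℤ)) (hXs : IsSkewDir X)
    (hsmall : Real.exp (4 * (800 * ((d : ℝ) + 1) ^ 2 * ((d : ℝ) + 4)) * α₀)
      * (1 + 8 * (131072 * ((d : ℝ) + 1) ^ 2) * ((L : ℝ) ^ (j + 1) * b)) ≤ 2)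
    (hc₃ : 4 * ((L : ℝ) ^ (j + 1) * b) ≤ c3 d L)
    (hK : 16 * (C1cov d * (L : ℝ) ^ 2 * Real.sqrt (d * (2 * (2 * L) + 1) ^ d)) * (L : ℝ) ^ (j + 1) * b ≤ Real.sqrt ((L : ℝ) ^ 2 / (L : ℝ) ^ d))
    (hS1 : (16 * (d + 1) * (d + 4) * (L : ℝ) ^ 2 * Csup d L * (d * (2 * nbRad d L + 1) ^ d)) * radSum d L j x ≤ ((L : ℝ) / (L : ℝ) ^ d) / 2)
    (h44 : 44 * ((d : ℝ) * L * ((L : ℝ) ^ (j + 1) * b)) ≤ 1)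
    (hrep : gaugeAct u UA = vary W X 1) (hcorner : ∀ z : Site d, u (((L : ℤ) ^ (j + 1)) • z) = 1)
    (hA : avgIter L UA (j + 1) = D) (hW : avgIter L W (j + 1) = D)
    (hv1 : ∀ z : Site d, vcov L W (relPert W X) (j + 1) z = 1)
    {Γ₁ Γ₂ Γ₃ Γ₄ : ℝ} (hΓ₁ : ∑ m ∈ range (j + 1), (L : ℝ) ^ m * ((L : ℝ) ^ 2 / (L : ℝ) ^ d) ^ m ≤ Γ₁)
    (hΓ₂ : ((j : ℝ) + 1) * ∑ i ∈ range j, ((L : ℝ) ^ 2 * ((L : ℝ) ^ 2 / (L : ℝ) ^ d)) ^ i ≤ Γ₂ * ((L : ℝ) ^ (j + 1)) ^ 2)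
    (hΓ₃ : ∑ i ∈ range j, (((L : ℝ) / (L : ℝ) ^ d) * L) ^ i ≤ Γ₃) (hΓ₄ : ∑ m ∈ range (j + 1), ((L : ℝ) ^ 2 / (L : ℝ) ^ d) ^ m ≤ Γ₄) :
    ∃ (hYs : IsSkewDir (dirIter L (j + 1) W (fun y ν => X y ν - gaugeDir W (spikeW (L ^ (j + 1)) (framePotW L (j + 1) W X)) y ν)))
      (XN : Site d → Fin d → Matrix n n ℂ),
      XN = gaugeDir W (spikeW (L ^ (j + 1)) (framePotW L (j + 1) W X)) + rightInvW hL j hWu hx hsm hWx N hθ hYs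
      ∧ dirIter L (j + 1) W (fun y ν => X y ν - XN y ν) = 0
      ∧ IsSkewDir XN ∧ IsPeriodicDir XN ((N * L ^ (j + 1) : ℕ) : ℤ)
      ∧ energyNormW L (j + 1) W XN (periodBox (d := d) (N * L ^ (j + 1)))
          ≤ (2 * Real.sqrt (((Fintype.card (T4AveragingDeficitWall.Plane d) : ℝ) + d)
                * (8192 * ((d : ℝ) ^ 3 * (L : ℝ) ^ 5) * Γ₁ + 2048 * ((d : ℝ) * L) * (C1cov d * (L : ℝ) ^ 2 * Real.sqrt (d * (2 * (2 * L) + 1) ^ d)) ^ 2 * Γ₂))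
                * ((L : ℝ) ^ (j + 1) * b)
              + Real.sqrt ((l2C d L / (1 - thetaLoc d L * (((L : ℝ) ^ (j + 1)) ^ 2 * x)) ^ 2 + curl2C d L / (1 - thetaLoc d L * (((L : ℝ) ^ (j + 1)) ^ 2 * x)) ^ 2)
                  * (1024 * (C1cov d * (L : ℝ) ^ 2 * Real.sqrt (d * (2 * (2 * L) + 1) ^ d)) ^ 2 * ((L : ℝ) ^ d / (L : ℝ) ^ 4)))
                * ((L : ℝ) ^ (j + 1) * b))
            * energyNormW L (j + 1) W X (periodBox (d := d) (N * L ^ (j + 1)))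
      ∧ x * ∑ p ∈ perWin d (N * L ^ (j + 1)), ‖curl W XN p‖
          ≤ (2 * (Fintype.card (T4AveragingDeficitWall.Plane d) : ℝ)
                * (16 * ((d : ℝ) * L) * (6 * Γ₁ + 2 * Γ₄) + 64 * (C1cov d * (L : ℝ) ^ 2 * (d * (2 * (2 * (L : ℝ)) + 1) ^ d)) * Γ₃)
                * (((L : ℝ) ^ (j + 1)) ^ 2 * x) ^ 2
              + (curl1C d L / (1 - thetaLoc d L * (((L : ℝ) ^ (j + 1)) ^ 2 * x))) * (((L : ℝ) ^ (j + 1)) ^ 2 * x)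
                * (64 * (C1cov d * (L : ℝ) ^ 2 * (d * (2 * (2 * (L : ℝ)) + 1) ^ d)) * ((L : ℝ) ^ d / (L : ℝ) ^ 2)))
            * energyNormW L (j + 1) W X (periodBox (d := d) (N * L ^ (j + 1))) ^ 2 := by
  have hL1 : 1 ≤ L := by omega
  have hT : ((tower L N (j + 1) : ℕ) : ℤ) = ((N * L ^ (j + 1) : ℕ) : ℤ) := by rw [tower_eq_pow_mul, Nat.mul_comm]
  have hWPt : IsPeriodicCfg W ((tower L N (j + 1) : ℕ) : ℤ) := by rw [hT]; exact hWP
  have htop : ∀ z : Site d, mlog ((vcov L W (relPert W X) (j + 1) z : (Matrix n n ℂ)ˣ) : Matrix n n ℂ) = 0 :=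
    mlog_vcov_eq_zero_of_frameTrivial L W X j hv1
  -- the spikes `S`, the field `Y := X − S` and its k-fold linearised average
  set S : Site d → Fin d → Matrix n n ℂ := gaugeDir W (spikeW (L ^ (j + 1)) (framePotW L (j + 1) W X)) with hSdef
  have hSs : IsSkewDir S := isSkewDir_spikes hL1 j hWu hx hsm hWx hXs
  have hSP : IsPeriodicDir S ((N * L ^ (j + 1) : ℕ) : ℤ) := isPeriodicDir_spikes (N := N) hL1 j hWP hXP
  have hYs' : IsSkewDir (fun y ν => X y ν - S y ν) := fun y ν => (skewAdjoint (Matrix n n ℂ)).sub_mem (hXs y ν) (hSs y ν)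
  have hYPt : IsPeriodicDir (fun y ν => X y ν - S y ν) ((tower L N (j + 1) : ℕ) : ℤ) := by
    rw [hT]; intro y i ν; simp only; rw [hXP y i ν, hSP y i ν]
  have hYs : IsSkewDir (dirIter L (j + 1) W (fun y ν => X y ν - S y ν)) := dirIter_skew hL1 j hWu hx hsm hWx hYs'
  have hφP : IsPeriodicDir (dirIter L (j + 1) W (fun y ν => X y ν - S y ν)) (N : ℤ) := isPeriodicDir_dirIter L N (j + 1) hWPt hYPt
  have hid : dirIter L (j + 1) W (fun y ν => X y ν - S y ν) = QbarIter L (j + 1) W X :=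
    dirIter_sub_spikes_eq_QbarIter hL1 j hWu hWP hx hsm hWx hXs hXP
  -- the right-inverse piece
  set Nn := rightInvW hL j hWu hx hsm hWx N hθ hYs with hNn
  have hNs : IsSkewDir Nn := rightInvW_skew hL j hWu hx hsm hWx hθ hYs
  have hNP : IsPeriodicDir Nn ((N * L ^ (j + 1) : ℕ) : ℤ) := rightInvW_periodic hL j hWu hWPt hx hsm hWx hθ hYs
  refine ⟨hYs, S + Nn, rfl, ?_, ?_, ?_, ?_, ?_⟩
  · -- (i) tangency: `D(X − (S + Nn)) = D(X − S) − D Nn = D(X − S) − D(X − S) = 0`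
    have e : (fun y ν => X y ν - (S + Nn) y ν) = (fun y μ => (fun y ν => X y ν - S y ν) y μ - Nn y μ) := by
      funext y ν; simp only [Pi.add_apply]; rw [sub_add_eq_sub_sub]
    rw [e, dirIter_sub hL1 j hWu hx hsm hWx (fun y ν => X y ν - S y ν) Nn, hNn, rightInvW_exact hL j hWu hWPt hx hsm hWx hθ hYs hφP]
    funext z κ; simp only [sub_self, Pi.zero_apply]
  · -- (ii) skew
    intro y ν; simpa only [Pi.add_apply] using (skewAdjoint (Matrix n n ℂ)).add_mem (hSs y ν) (hNs y ν)
  · -- (iii) periodic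
    intro y i ν; simp only [Pi.add_apply]; rw [hSP y i ν, hNP y i ν]
  · -- (iv) the ν-letter
    have h1 := energyNormW_spikes_le_of_top hL hN j hWu hWP hx hsm hWx hε hα hα3 hα4 h52 hb hX hXP hsmall hc₃ hK h44 htop hΓ₁ hΓ₂
    have h2 := energyNormW_rightInv_le_of_frameTrivial hL hN j hWu hWP hx hsm hWx hθ hθl hε hα hα3 hα4 h52 hb hX hXP hsmall hc₃ hK hrep hcorner hA hW hv1 hYs hid
    have hadd := energyNormW_add_le L (j + 1) W S Nn (periodBox (d := d) (N * L ^ (j + 1)))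
    refine hadd.trans ?_
    rw [add_mul]
    exact add_le_add h1 h2
  · -- (v) the κ-letter
    have h1 := curlL1_spikes_le_of_top hL hN j hWu hWP hx hsm hWx hα hα3 hα4 h52 hb hX hXP hsmall hc₃ hK hS1 h44 htop hΓ₁ hΓ₃ hΓ₄
    have h2 := curlL1_rightInv_le_of_frameTrivial hL hN j hWu hWP hx hsm hWx hθ hθl hε hα hα3 hα4 h52 hb hX hXP hsmall hc₃ hK hS1 hrep hcorner hA hW hv1 hYs hid
    have hsum : ∑ p ∈ perWin d (N * L ^ (j + 1)), ‖curl W (S + Nn) p‖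
        ≤ ∑ p ∈ perWin d (N * L ^ (j + 1)), ‖curl W S p‖ + ∑ p ∈ perWin d (N * L ^ (j + 1)), ‖curl W Nn p‖ := by
      rw [← Finset.sum_add_distrib]
      refine Finset.sum_le_sum fun p _ => ?_
      rw [curl_add_dir]; exact norm_add_le _ _
    calc x * ∑ p ∈ perWin d (N * L ^ (j + 1)), ‖curl W (S + Nn) p‖
        ≤ x * (∑ p ∈ perWin d (N * L ^ (j + 1)), ‖curl W S p‖ + ∑ p ∈ perWin d (N * L ^ (j + 1)), ‖curl W Nn p‖) :=
          mul_le_mul_of_nonneg_left hsum hx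
      _ = x * ∑ p ∈ perWin d (N * L ^ (j + 1)), ‖curl W S p‖ + x * ∑ p ∈ perWin d (N * L ^ (j + 1)), ‖curl W Nn p‖ := mul_add _ _ _
      _ ≤ _ := by rw [add_mul]; exact add_le_add h1 h2

end

end Summit.QuantumFields.BalabanUV.T4Continuum.NE7TopNormalisedResidualLetters
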